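import Literature.MathematicalPhysics.QuantumFieldTheory.Balaban1983to89.Node00.TorusCoverGaugeTokens152153Box
import Literature.MathematicalPhysics.QuantumFieldTheory.Balaban1983to89.Node00.TorusCoverLandau153REFiner
import Literature.MathematicalPhysics.QuantumFieldTheory.Balaban1983to89.Node00.TorusCoverCollarOfMeetsPrint

/-!
# NODE 00 — THE FAMILIES-LEVEL (152)+(153) DOOR OF [Balaban1985Variational] WITH (153) AT EVERY KERNEL-FINER FAMILY `D′` (the boundary-datum family of print's (150)
# included), AT INTERIOR DATUMS AND AT EVERY DATUM MEETING `Ω_n`: generation 3's `gauge152_RE153_box_of_prop6P` re-issued with the sixth clause over all `D′` with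
# `ker Q′_{D′} ≤ ker Q′_{cubeDomains}`, and re-run once with the interior hypothesis `□ ⊆ Ω_n` replaced by the S6 head's `Within`-witness

Cell `pub-ymgap`, width seat `pub-ymgap-dag-n07-w3` generation 5, CLAIM-2 ∕ INTENT-2 (cell INBOX 2026-08-28).  NEW leaf, PROOF kind (no `def`, no `instance`, no `notation`).
CONSUMED BY NAME, nothing modified: generation 3's `Node00.TorusCoverGaugeTokens152153Box` (`gauge152_RE153_box_of_prop6P`, `…_of_one_le`, `gauge9_152_RE153_box_of_prop8TopStep_of_prop6P`
— and, in §2, its proof text verbatim up to two lines), generation 5's `Node00.TorusCoverLandau153REFiner` (`RE_eq_zero_of_ker_le`, `exists_localGauge152_REfiner153_coverBox_propCubeP_of_prop6P`),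
`pub-ymgap-dag-n07-w4`'s `Node00.TorusCoverCollarOfMeetsPrint` (`Sect2.hcollar_cubeIdxP'_of_within_mem` — the collar clause of the door from a `Within`-witness); dag-n07-e's FILE P3
`Node00.TorusCoverGaugeTokensRPrint` (`b9OfP`, `a0OfP`, `a0OfP_pos`), FILE P1 (`propCubeP`, `cubeIdxP'`, `sideP`, `sideP_le`, `le_sideP`, `boxWidth_propCubeP`) and module 39 `cubeDomains`;
k0-s2-w2's `prop6Printed_zdCubP_anti`; def-R's `suppDomOfRecord` (`suppDomOfRecord_eq`); N07's `Prop8RegSepTopStep` (HYPOTHESIS); lit-balaban p21's `RE` ∕ `dsE` ∕ `QpE` and `Domains`.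
`--kind proof --supports stmt-QuantumFields-20542` (K1⁷; count-neutral).  [15] = [Balaban1985Variational]; [6] = [Balaban1985RegularSpaces]; [B6] = [Balaban1984PropagatorsII]; [III] = [Balaban1988Convergent].

WHY.  The S6 head at the record (`pub-ymgap-dag-n07-w4`'s per-datum tokens) serves grid cubes that MEET `Ω_n` — boundary datums, [15] p. 300 *«a cube □ intersecting Ω_j»* — through
the collar `□̃ ⊂ Ω_{n−1}` obtained from a `Within`-witness, and the heart at EVERY datum is to be keyed (lane owner `pub-ymgap-dag-n07-e`, cell INBOX 2026-08-28) on a family `D″`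
levelwise SMALLER than the datum's cube tower (`D″ = cubeDomains ⊓ shrink (domainsOfSeq s)`: print's (150) *«Ω′_j = □_j, j < k, Ω′_k = □″_k»*, one big-block layer finer at the
record's interfaces).  Generation 3's families-level door reads (153) at `cubeDomains` only and its interior hypothesis `hΩ : □ ⊆ Ω_n` fails at a boundary datum.  THIS FILE: §1 the
interior door with the sixth clause over every kernel-finer `D′` (three-line corollaries of p607847 by the nesting `R_{cube}v = 0 ⟹ R_{D′}v = 0` of generation 5's
`RE_eq_zero_of_ker_le`); §2 ★★★ the door at every datum MEETING `Ω_n` — the same binder block with `hΩ` replaced by the `Within`-witness `(x ∈ cubeExt (side L M₀ n) a 0, π y ∈ Ω_n,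
Within Dw x y)` and the floor `(11·4 + 4ρ + M₀ + Dw)·L ≤ ν.M₁`, generation 3's derivation verbatim except that the collar clause is dag-n07-w4's lemma and the last line is generation
5's finer generic-`P` door (+ its `ρ := ρ₀·L` form for stub 2′'s bare `ρ₀ ≥ 1`); §3 the (9)–(10) composition for critical configurations, sixth clause finer.  ONE call per datum for the head, then `h₆ D″ (ker_QpE_le_of_domainsLe (domainsMeet_le_left …)) φ`.

HONEST FRAMING: count-neutral kernel-lane compositions by name (no new estimate; §2 re-runs generation 3's arithmetic bookkeeping once); [6] Proposition 6 on print's class at the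
member is the HYPOTHESIS `hP6` (N05's node ∕ stub 2′'s body; never asserted here), applied to the CUBE datum only; stub 1's `Prop8RegSepTopStep` is the HYPOTHESIS `h8` of §3; the
non-wrapping of the datum's collared cube, the floors, the radii and the `Within`-witness are DISPLAYED; the kernel inclusion of clause 6 is a hypothesis of that clause (its
inhabitant at `D″` is dag-n07-e's `DomainsRefinement` ∕ `DomainsMeet`); nothing of Bałaban discharged; tokens ∕ stub 1 ∕ stub 2′ ∕ N07 ∕ N05 ∕ K0⁷ ∕ K1⁷ NOT closed; counts unmoved
(typed 28∕28 · discharged 5∕27); one finite 𝕋⁴ programme at fixed ε — R4 closes the conditional finite-𝕋⁴ rung `BalabanLadder.UV` only; the YM mass gap (Clay) is NOT proved by any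
of this; nothing continuum ∕ ℝ⁴ ∕ infinite volume ∕ OS.  No `sorry`, no `def`, no `instance`, no `notation`.
-/

noncomputable section

namespace Literature.MathematicalPhysics.QuantumFieldTheory.Balaban1983to89.Node00

open scoped Matrix.Norms.L2Operator InnerProductSpace RealInnerProductSpace
open T4Continuum (T4Family)
open B15DeterminingSets B12RegularSpaces111
open B15Eq112TorusCover (cover)
open B14DomainGeom (Pt Within)
open B14.Eq213MaximalDomains (side cubeExt)
open B7Prop1Explicit (e)
open B8Eq131Cubes (box cube tcube bLo bHi)
open B8LeafModelZd (ZdIdx)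
open B6SectADomainsV1 (Domains)
open B6SectAOperatorsV1 (RE dsE QpE)
open BalabanImbrieJaffe1984to88.BIJ85AxialPropagator411 (BondSpace)

variable {F : T4Family} {N : ℕ} [NeZero N]

/-! ## §1  Interior datums (`□ ⊆ Ω_n`): the sixth clause over every kernel-finer family -/

section Interior

/-- ★★ **THE FAMILIES-LEVEL DOOR AT AN INTERIOR DATUM, WITH (153) AT EVERY KERNEL-FINER FAMILY**: generation 3's `gauge152_RE153_box_of_prop6P` (binder block BYTE FOR BYTE:
[6] Prop. 6 on print's class — the HYPOTHESIS `hP6`; `1 ≤ M`; a separated index `s` with the floor `(11·4 + 4ρ)·L ≤ ν.M₁`; level radii `0 < ε_m ≤ a0OfP`, `ε_m ≤ 2ε_{m+1}`; `U` in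
the (1.7)∕(1.9)-Top class over `suppDomOfRecord`; `1 ≤ n ≤ k`, `n ≤ m + K`; `M₀ ∈ {M, L·M}`; a grid cube `cubeEnl (F.P K) (LⁿM₀) a 0 ⊆ Ω_n`; the non-wrapping of the datum's collared
cube) with the sixth clause quantified over every `D′ : Domains (F.P K)` with `ker Q′_{D′} ≤ ker Q′_{cubeDomains 𝔔}` — ONE gauge `u`, ONE potential `A`: the five (152) clauses on
`π '' box(𝔔)` at `< b9OfP·ε_n` and, for every such `D′` and every `φ`, `RE D′ η_n⁻¹ (dsE η_n⁻¹ (Re ∕ Im(φ∘A))) = 0`.  At the heart's family `D″ = cubeDomains 𝔔 ⊓ …` of a datum the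
inclusion is dag-n07-e's `ker_QpE_le_of_domainsLe (domainsMeet_le_left …)`; at `D′ := cubeDomains 𝔔` it is `le_rfl` (p607847 verbatim).  Proof: p607847 + the nesting of [B6] (2.12)'s
projections (`RE_eq_zero_of_ker_le`).
[cite: Balaban1985Variational, (144)–(153) pp.300–301; Balaban1985RegularSpaces, Prop. 6 (1.135)–(1.138) p.99, (1.38) p.82; Balaban1984PropagatorsII, (2.7) p.224, (2.10)–(2.12) p.225; Balaban1988Convergent, (2.13) p.256] -/
theorem gauge152_REfiner153_box_of_prop6P {B₁ c₁ : ℝ} (hB₁ : 0 ≤ B₁) (hc₁ : 0 < c₁) {ρ : ℕ}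
    (hP6 : letI : CStarAlgebra (MatA N) := {}; B8.Prop6Printed 4 (F.L : ℝ) B₁ c₁ (fun i : ZdIdx 4 F.L => zdCubP (MatA N) F.L ρ i)) {M : ℕ} (hM : 1 ≤ M)
    (ν : Stage7Numerics) (g : ℕ → ℝ) (K k : ℕ) (hρ : (F.P K).L ≤ ρ) (s : SeqOfRecord F ν M g K k) (hsep : Sect2.SeqSeparated ν.M₁ s)
    (hfloor : (11 * 4 + 4 * ρ) * F.L ≤ ν.M₁) (ε : ℕ → ℝ)
    (hε : ∀ m, m ≤ k → 0 < ε m ∧ ε m ≤ a0OfP F N M ρ B₁ c₁) (hcomp : ∀ m, m < k → ε m ≤ 2 * ε (m + 1))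
    (U : GaugeField (F.P K) 0 (SU N))
    (h17 : ∀ m, m ≤ k → PlaqSmallOn (Sect2.omegaPlaqsTop s.Ω (suppDomOfRecord F ν K s.Ω) m) (ε m * (F.P K).eta m ^ 2) U)
    (h19 : ∀ m, m ≤ k → Sect2.CoDivSmallOn (Sect2.omegaBondsTop s.Ω (suppDomOfRecord F ν K s.Ω) m) (ε m * (F.P K).eta m ^ 3) U)
    {n : ℕ} (hn1 : 1 ≤ n) (hnk : n ≤ k) (hnK : n ≤ (F.P K).m + (F.P K).K) {M₀ : ℕ} (hM₀ : M₀ = M ∨ M₀ = F.L * M)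
    (a : Pt (F.P K).d) (hΩ : cubeEnl (F.P K) (side (F.P K).L M₀ n) a 0 ⊆ s.Ω n)
    (hinj : Set.InjOn (cover (F.P K))
      (cube (F.P K).L (propCubeP (F.P K) n hn1 M₀ ρ hρ a).a (propCubeP (F.P K) n hn1 M₀ ρ hρ a).M (propCubeP (F.P K) n hn1 M₀ ρ hρ a).ρ n 0)) :
    ∃ u : GaugeTransf (F.P K) 0 (SU N), ∃ A : PBond (F.P K) 0 → MatA N,
      (∀ b ∈ (Sect2.regionOfSet (F.P K)
          (cover (F.P K) '' box (F.P K).L (propCubeP (F.P K) n hn1 M₀ ρ hρ a).a (propCubeP (F.P K) n hn1 M₀ ρ hρ a).M n)).bonds,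
          gaugeU (fun x => ιSU N (u x)) (fun b' => ιSU N (U b')) b = expI ((F.P K).eta n) (A b)) ∧
      (∀ b ∈ (Sect2.regionOfSet (F.P K)
          (cover (F.P K) '' box (F.P K).L (propCubeP (F.P K) n hn1 M₀ ρ hρ a).a (propCubeP (F.P K) n hn1 M₀ ρ hρ a).M n)).bonds,
          ‖A b‖ < b9OfP F M ρ B₁ * ε n) ∧
      (∀ q ∈ (Sect2.regionOfSet (F.P K)
          (cover (F.P K) '' box (F.P K).L (propCubeP (F.P K) n hn1 M₀ ρ hρ a).a (propCubeP (F.P K) n hn1 M₀ ρ hρ a).M n)).dpairs,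
          ‖grad ((F.P K).eta n) q.2.1 (fun y => A ⟨y, q.2.2⟩) q.1‖ < b9OfP F M ρ B₁ * ε n) ∧
      (∀ b ∈ Sect2.bondsDeep (cover (F.P K) '' box (F.P K).L (propCubeP (F.P K) n hn1 M₀ ρ hρ a).a (propCubeP (F.P K) n hn1 M₀ ρ hρ a).M n),
          ‖Sect2.codiffCurlA ((F.P K).eta n) A b.src b.dir‖ < b9OfP F M ρ B₁ * ε n) ∧
      (∀ b ∈ Sect2.bondsDeep (cover (F.P K) '' box (F.P K).L (propCubeP (F.P K) n hn1 M₀ ρ hρ a).a (propCubeP (F.P K) n hn1 M₀ ρ hρ a).M n),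
          ‖∑ ν' : Fin (F.P K).d, (((F.P K).eta n : ℝ) : ℂ)⁻¹ •
              (grad ((F.P K).eta n) ν' (fun y => A ⟨y, b.dir⟩) (b.src.unshift ν') - grad ((F.P K).eta n) ν' (fun y => A ⟨y, b.dir⟩) b.src)‖ <
            b9OfP F M ρ B₁ * ε n) ∧
      (∀ D' : Domains (F.P K),
        LinearMap.ker (QpE D') ≤ LinearMap.ker (QpE (cubeDomains (F.P K) (propCubeP (F.P K) n hn1 M₀ ρ hρ a).a (propCubeP (F.P K) n hn1 M₀ ρ hρ a).M ρ n hnK)) →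
        ∀ φ : MatA N →L[ℂ] ℂ,
          RE D' ((F.P K).eta n)⁻¹ (dsE ((F.P K).eta n)⁻¹ (WithLp.toLp 2 fun b => (φ (A b)).re : BondSpace (F.P K))) = 0 ∧
          RE D' ((F.P K).eta n)⁻¹ (dsE ((F.P K).eta n)⁻¹ (WithLp.toLp 2 fun b => (φ (A b)).im : BondSpace (F.P K))) = 0) := by
  obtain ⟨u, A, h1, h2, h3, h4, h5, h6⟩ :=
    gauge152_RE153_box_of_prop6P hB₁ hc₁ hP6 hM ν g K k hρ s hsep hfloor ε hε hcomp U h17 h19 hn1 hnk hnK hM₀ a hΩ hinj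
  exact ⟨u, A, h1, h2, h3, h4, h5, fun D' hD' φ => ⟨RE_eq_zero_of_ker_le hD' (h6 φ).1, RE_eq_zero_of_ker_le hD' (h6 φ).2⟩⟩

/-- ★ **THE SAME AT STUB 2′'s BARE `ρ₀ ≥ 1`** (`ρ := ρ₀·L`; p607847's `_of_one_le` binder block, sixth clause over every kernel-finer `D′`).
[cite: Balaban1985Variational, (144)–(153) pp.300–301; Balaban1985RegularSpaces, Prop. 6 p.99, p.98; Balaban1984PropagatorsII, (2.12) p.225] -/
theorem gauge152_REfiner153_box_of_prop6P_of_one_le {B₁ c₁ : ℝ} (hB₁ : 0 ≤ B₁) (hc₁ : 0 < c₁) {ρ₀ : ℕ} (hρ₀ : 1 ≤ ρ₀)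
    (hP6 : letI : CStarAlgebra (MatA N) := {}; B8.Prop6Printed 4 (F.L : ℝ) B₁ c₁ (fun i : ZdIdx 4 F.L => zdCubP (MatA N) F.L ρ₀ i)) {M : ℕ} (hM : 1 ≤ M)
    (ν : Stage7Numerics) (g : ℕ → ℝ) (K k : ℕ) (s : SeqOfRecord F ν M g K k) (hsep : Sect2.SeqSeparated ν.M₁ s)
    (hfloor : (11 * 4 + 4 * (ρ₀ * F.L)) * F.L ≤ ν.M₁) (ε : ℕ → ℝ)
    (hε : ∀ m, m ≤ k → 0 < ε m ∧ ε m ≤ a0OfP F N M (ρ₀ * F.L) B₁ c₁) (hcomp : ∀ m, m < k → ε m ≤ 2 * ε (m + 1))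
    (U : GaugeField (F.P K) 0 (SU N))
    (h17 : ∀ m, m ≤ k → PlaqSmallOn (Sect2.omegaPlaqsTop s.Ω (suppDomOfRecord F ν K s.Ω) m) (ε m * (F.P K).eta m ^ 2) U)
    (h19 : ∀ m, m ≤ k → Sect2.CoDivSmallOn (Sect2.omegaBondsTop s.Ω (suppDomOfRecord F ν K s.Ω) m) (ε m * (F.P K).eta m ^ 3) U)
    {n : ℕ} (hn1 : 1 ≤ n) (hnk : n ≤ k) (hnK : n ≤ (F.P K).m + (F.P K).K) {M₀ : ℕ} (hM₀ : M₀ = M ∨ M₀ = F.L * M)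
    (a : Pt (F.P K).d) (hΩ : cubeEnl (F.P K) (side (F.P K).L M₀ n) a 0 ⊆ s.Ω n)
    (hinj : Set.InjOn (cover (F.P K))
      (cube (F.P K).L (propCubeP (F.P K) n hn1 M₀ (ρ₀ * F.L) (Nat.le_mul_of_pos_left F.L hρ₀) a).a
        (propCubeP (F.P K) n hn1 M₀ (ρ₀ * F.L) (Nat.le_mul_of_pos_left F.L hρ₀) a).M
        (propCubeP (F.P K) n hn1 M₀ (ρ₀ * F.L) (Nat.le_mul_of_pos_left F.L hρ₀) a).ρ n 0)) :
    ∃ u : GaugeTransf (F.P K) 0 (SU N), ∃ A : PBond (F.P K) 0 → MatA N,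
      (∀ b ∈ (Sect2.regionOfSet (F.P K)
          (cover (F.P K) '' box (F.P K).L (propCubeP (F.P K) n hn1 M₀ (ρ₀ * F.L) (Nat.le_mul_of_pos_left F.L hρ₀) a).a
            (propCubeP (F.P K) n hn1 M₀ (ρ₀ * F.L) (Nat.le_mul_of_pos_left F.L hρ₀) a).M n)).bonds,
          gaugeU (fun x => ιSU N (u x)) (fun b' => ιSU N (U b')) b = expI ((F.P K).eta n) (A b)) ∧
      (∀ b ∈ (Sect2.regionOfSet (F.P K)
          (cover (F.P K) '' box (F.P K).L (propCubeP (F.P K) n hn1 M₀ (ρ₀ * F.L) (Nat.le_mul_of_pos_left F.L hρ₀) a).a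
            (propCubeP (F.P K) n hn1 M₀ (ρ₀ * F.L) (Nat.le_mul_of_pos_left F.L hρ₀) a).M n)).bonds,
          ‖A b‖ < b9OfP F M (ρ₀ * F.L) B₁ * ε n) ∧
      (∀ q ∈ (Sect2.regionOfSet (F.P K)
          (cover (F.P K) '' box (F.P K).L (propCubeP (F.P K) n hn1 M₀ (ρ₀ * F.L) (Nat.le_mul_of_pos_left F.L hρ₀) a).a
            (propCubeP (F.P K) n hn1 M₀ (ρ₀ * F.L) (Nat.le_mul_of_pos_left F.L hρ₀) a).M n)).dpairs,
          ‖grad ((F.P K).eta n) q.2.1 (fun y => A ⟨y, q.2.2⟩) q.1‖ < b9OfP F M (ρ₀ * F.L) B₁ * ε n) ∧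
      (∀ b ∈ Sect2.bondsDeep (cover (F.P K) '' box (F.P K).L (propCubeP (F.P K) n hn1 M₀ (ρ₀ * F.L) (Nat.le_mul_of_pos_left F.L hρ₀) a).a
            (propCubeP (F.P K) n hn1 M₀ (ρ₀ * F.L) (Nat.le_mul_of_pos_left F.L hρ₀) a).M n),
          ‖Sect2.codiffCurlA ((F.P K).eta n) A b.src b.dir‖ < b9OfP F M (ρ₀ * F.L) B₁ * ε n) ∧
      (∀ b ∈ Sect2.bondsDeep (cover (F.P K) '' box (F.P K).L (propCubeP (F.P K) n hn1 M₀ (ρ₀ * F.L) (Nat.le_mul_of_pos_left F.L hρ₀) a).a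
            (propCubeP (F.P K) n hn1 M₀ (ρ₀ * F.L) (Nat.le_mul_of_pos_left F.L hρ₀) a).M n),
          ‖∑ ν' : Fin (F.P K).d, (((F.P K).eta n : ℝ) : ℂ)⁻¹ •
              (grad ((F.P K).eta n) ν' (fun y => A ⟨y, b.dir⟩) (b.src.unshift ν') - grad ((F.P K).eta n) ν' (fun y => A ⟨y, b.dir⟩) b.src)‖ <
            b9OfP F M (ρ₀ * F.L) B₁ * ε n) ∧
      (∀ D' : Domains (F.P K),
        LinearMap.ker (QpE D') ≤ LinearMap.ker (QpE (cubeDomains (F.P K) (propCubeP (F.P K) n hn1 M₀ (ρ₀ * F.L) (Nat.le_mul_of_pos_left F.L hρ₀) a).a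
          (propCubeP (F.P K) n hn1 M₀ (ρ₀ * F.L) (Nat.le_mul_of_pos_left F.L hρ₀) a).M (ρ₀ * F.L) n hnK)) →
        ∀ φ : MatA N →L[ℂ] ℂ,
          RE D' ((F.P K).eta n)⁻¹ (dsE ((F.P K).eta n)⁻¹ (WithLp.toLp 2 fun b => (φ (A b)).re : BondSpace (F.P K))) = 0 ∧
          RE D' ((F.P K).eta n)⁻¹ (dsE ((F.P K).eta n)⁻¹ (WithLp.toLp 2 fun b => (φ (A b)).im : BondSpace (F.P K))) = 0) := by
  letI : CStarAlgebra (MatA N) := {}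
  exact gauge152_REfiner153_box_of_prop6P hB₁ hc₁ (prop6Printed_zdCubP_anti (fun i : ZdIdx 4 F.L => i) (Dvd.intro F.L rfl) hP6) hM ν g K k
    (Nat.le_mul_of_pos_left F.L hρ₀) s hsep hfloor ε hε hcomp U h17 h19 hn1 hnk hnK hM₀ a hΩ hinj

end Interior

/-! ## §2  ★★★ Every datum MEETING `Ω_n` (boundary datums included): the `Within`-witness edition -/

section Meeting

/-- ★★★ **THE FAMILIES-LEVEL DOOR AT EVERY DATUM MEETING `Ω_n` — BOUNDARY DATUMS INCLUDED —, WITH (153) AT EVERY KERNEL-FINER FAMILY** ([15] p. 300: *«Let us take a cube □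
intersecting Ω_j but not Ω_{j+1}»*; p. 301 (150)–(153): the family `{Ω′_j}`, *«more restrictive functional conditions»*, *«R∂^{η*}A = 0, where the operator R is defined for the
sequence {Ω′_j}»*).  The binder block of `gauge152_REfiner153_box_of_prop6P` with the interior hypothesis `hΩ : cubeEnl … ⊆ Ω_n` REPLACED by a `Within`-WITNESS — a point
`x` of the grid cube `cubeExt (side L M₀ n) a 0` within `Dw` of a lift `y` of a site of `Ω_n` (the meeting condition of the S6 head's per-datum tokens) — and the single floor
`(11·4 + 4ρ + M₀ + Dw)·L ≤ ν.M₁`; the collar clause `π((cubeIdxP' …).Ω 0) ⊆ Ω_{n−1}` (resp. the support at `n = 1`) is dag-n07-w4's `Sect2.hcollar_cubeIdxP'_of_within_mem` BY NAME,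
the rest of generation 3's derivation (print side `sideP ≤ M₀ + 44 + 2ρ`, «7dL²M′α₀ ≤ c₁» and the `2π`-window from `ε_{n−1} ≤ a0OfP`, letters at `2r < b9OfP·ε_n`) verbatim.
CONCLUSION: the five (152) clauses on `π '' box(𝔔)` at `< b9OfP·ε_n` and, for every `D′` with `ker Q′_{D′} ≤ ker Q′_{cubeDomains 𝔔}` and every `φ`,
`RE D′ η_n⁻¹ (dsE η_n⁻¹ (Re ∕ Im(φ∘A))) = 0` — [6] Prop. 6 ∕ Thm 2 applied ONCE, at the CUBE datum (the record's level-(n−1) smallness on the collared cube implies the cube-keyed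
class), whose Landau condition `R_{cube}∂*A = 0` is stronger than print's `R_{Ω′}∂*A = 0`.  [6] Prop. 6 on print's class is the HYPOTHESIS `hP6`.
[cite: Balaban1985Variational, (144) p.300, (150)–(153) p.301, p.302; Balaban1985RegularSpaces, Prop. 6 (1.135)–(1.138) p.99, p.98, (1.38) p.82; Balaban1984PropagatorsII, (2.7) p.224, (2.10)–(2.12) p.225; Balaban1988Convergent, p.255, (2.13) p.256] -/
theorem gauge152_REfiner153_box_of_within_of_prop6P {B₁ c₁ : ℝ} (hB₁ : 0 ≤ B₁) (hc₁ : 0 < c₁) {ρ : ℕ}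
    (hP6 : letI : CStarAlgebra (MatA N) := {}; B8.Prop6Printed 4 (F.L : ℝ) B₁ c₁ (fun i : ZdIdx 4 F.L => zdCubP (MatA N) F.L ρ i)) {M : ℕ} (hM : 1 ≤ M)
    (ν : Stage7Numerics) (g : ℕ → ℝ) (K k : ℕ) (hρ : (F.P K).L ≤ ρ) (s : SeqOfRecord F ν M g K k) (hsep : Sect2.SeqSeparated ν.M₁ s)
    (ε : ℕ → ℝ)
    (hε : ∀ m, m ≤ k → 0 < ε m ∧ ε m ≤ a0OfP F N M ρ B₁ c₁) (hcomp : ∀ m, m < k → ε m ≤ 2 * ε (m + 1))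
    (U : GaugeField (F.P K) 0 (SU N))
    (h17 : ∀ m, m ≤ k → PlaqSmallOn (Sect2.omegaPlaqsTop s.Ω (suppDomOfRecord F ν K s.Ω) m) (ε m * (F.P K).eta m ^ 2) U)
    (h19 : ∀ m, m ≤ k → Sect2.CoDivSmallOn (Sect2.omegaBondsTop s.Ω (suppDomOfRecord F ν K s.Ω) m) (ε m * (F.P K).eta m ^ 3) U)
    {n : ℕ} (hn1 : 1 ≤ n) (hnk : n ≤ k) (hnK : n ≤ (F.P K).m + (F.P K).K) {M₀ : ℕ} (hM₀ : M₀ = M ∨ M₀ = F.L * M)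
    {Dw : ℕ} (hfloor : (11 * 4 + 4 * ρ + M₀ + Dw) * F.L ≤ ν.M₁) (a : Pt (F.P K).d) {x y : Pt (F.P K).d}
    (hx : x ∈ cubeExt (side (F.P K).L M₀ n) a 0) (hy : cover (F.P K) y ∈ s.Ω n) (hxy : Within (Dw : ℤ) x y)
    (hinj : Set.InjOn (cover (F.P K))
      (cube (F.P K).L (propCubeP (F.P K) n hn1 M₀ ρ hρ a).a (propCubeP (F.P K) n hn1 M₀ ρ hρ a).M (propCubeP (F.P K) n hn1 M₀ ρ hρ a).ρ n 0)) :
    ∃ u : GaugeTransf (F.P K) 0 (SU N), ∃ A : PBond (F.P K) 0 → MatA N,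
      (∀ b ∈ (Sect2.regionOfSet (F.P K)
          (cover (F.P K) '' box (F.P K).L (propCubeP (F.P K) n hn1 M₀ ρ hρ a).a (propCubeP (F.P K) n hn1 M₀ ρ hρ a).M n)).bonds,
          gaugeU (fun x => ιSU N (u x)) (fun b' => ιSU N (U b')) b = expI ((F.P K).eta n) (A b)) ∧
      (∀ b ∈ (Sect2.regionOfSet (F.P K)
          (cover (F.P K) '' box (F.P K).L (propCubeP (F.P K) n hn1 M₀ ρ hρ a).a (propCubeP (F.P K) n hn1 M₀ ρ hρ a).M n)).bonds,
          ‖A b‖ < b9OfP F M ρ B₁ * ε n) ∧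
      (∀ q ∈ (Sect2.regionOfSet (F.P K)
          (cover (F.P K) '' box (F.P K).L (propCubeP (F.P K) n hn1 M₀ ρ hρ a).a (propCubeP (F.P K) n hn1 M₀ ρ hρ a).M n)).dpairs,
          ‖grad ((F.P K).eta n) q.2.1 (fun y => A ⟨y, q.2.2⟩) q.1‖ < b9OfP F M ρ B₁ * ε n) ∧
      (∀ b ∈ Sect2.bondsDeep (cover (F.P K) '' box (F.P K).L (propCubeP (F.P K) n hn1 M₀ ρ hρ a).a (propCubeP (F.P K) n hn1 M₀ ρ hρ a).M n),
          ‖Sect2.codiffCurlA ((F.P K).eta n) A b.src b.dir‖ < b9OfP F M ρ B₁ * ε n) ∧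
      (∀ b ∈ Sect2.bondsDeep (cover (F.P K) '' box (F.P K).L (propCubeP (F.P K) n hn1 M₀ ρ hρ a).a (propCubeP (F.P K) n hn1 M₀ ρ hρ a).M n),
          ‖∑ ν' : Fin (F.P K).d, (((F.P K).eta n : ℝ) : ℂ)⁻¹ •
              (grad ((F.P K).eta n) ν' (fun y => A ⟨y, b.dir⟩) (b.src.unshift ν') - grad ((F.P K).eta n) ν' (fun y => A ⟨y, b.dir⟩) b.src)‖ <
            b9OfP F M ρ B₁ * ε n) ∧
      (∀ D' : Domains (F.P K),
        LinearMap.ker (QpE D') ≤ LinearMap.ker (QpE (cubeDomains (F.P K) (propCubeP (F.P K) n hn1 M₀ ρ hρ a).a (propCubeP (F.P K) n hn1 M₀ ρ hρ a).M ρ n hnK)) →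
        ∀ φ : MatA N →L[ℂ] ℂ,
          RE D' ((F.P K).eta n)⁻¹ (dsE ((F.P K).eta n)⁻¹ (WithLp.toLp 2 fun b => (φ (A b)).re : BondSpace (F.P K))) = 0 ∧
          RE D' ((F.P K).eta n)⁻¹ (dsE ((F.P K).eta n)⁻¹ (WithLp.toLp 2 fun b => (φ (A b)).im : BondSpace (F.P K))) = 0) := by
  letI : CStarAlgebra (MatA N) := {}
  have hL2 : 2 ≤ F.L := (F.P 0).hL.2
  have hd : 2 ≤ (F.P K).d := by rw [T4Family.P_d]; norm_num
  set M₂ : ℕ := F.L * M + 44 + 2 * ρ with hM₂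
  have ha₀ := a0OfP_pos (F := F) (N := N) M ρ hB₁ hc₁
  have hεn : 0 < ε n := (hε n hnk).1
  have hMpos : 0 < M := hM
  -- the cube letter `M₀ ∈ {M, LM}` is positive and `M₀ + 44 + 2ρ ≤ M₂` (generation 0's bookkeeping, verbatim)
  have hM₀pos : 1 ≤ M₀ := by
    rcases hM₀ with h | h
    · rw [h]; exact hMpos
    · rw [h]; exact Nat.one_le_iff_ne_zero.2 (Nat.mul_ne_zero (F.P 0).L_pos.ne' hMpos.ne')
  have hM₀' : M₀ + 44 + 2 * ρ ≤ M₂ := by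
    rcases hM₀ with h | h
    · rw [h, hM₂]; nlinarith [(F.P 0).L_pos]
    · rw [h, hM₂]
  have hεn1 : 0 < ε (n - 1) := (hε (n - 1) (by omega)).1
  have hεn1a : ε (n - 1) ≤ a0OfP F N M ρ B₁ c₁ := (hε (n - 1) (by omega)).2
  have hε2 : ε (n - 1) ≤ 2 * ε n := by
    have := hcomp (n - 1) (by omega)
    rwa [show n - 1 + 1 = n by omega] at this
  -- the print side `M′ = sideP ≤ M₀ + 44 + 2ρ ≤ M₂`
  have hside : sideP (F.P K) M₀ ρ ≤ M₂ := by
    have := sideP_le (P := F.P K) M₀ ρ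
    rw [T4Family.P_d] at this
    omega
  have hM'r : ((sideP (F.P K) M₀ ρ : ℕ) : ℝ) ≤ (M₂ : ℝ) := by exact_mod_cast hside
  have hM'pos : (0 : ℝ) < ((sideP (F.P K) M₀ ρ : ℕ) : ℝ) := by
    have := le_sideP (P := F.P K) M₀ (lt_of_lt_of_le (F.P K).L_pos hρ)
    exact_mod_cast (show 0 < sideP (F.P K) M₀ ρ by omega)
  have hM₂pos : (0 : ℝ) < M₂ := lt_of_lt_of_le hM'pos hM'r
  -- the collar clause, FROM THE `Within`-WITNESS (dag-n07-w4's `Sect2.hcollar_cubeIdxP'_of_within_mem`, by name)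
  have hM₁ : 1 ≤ ν.M₁ := le_trans (Nat.one_le_iff_ne_zero.2 (Nat.mul_ne_zero (by omega) (by omega))) hfloor
  have hfloor' : (11 * (F.P K).d + 4 * ρ + M₀ + Dw) * (F.P K).L ≤ ν.M₁ := by rw [T4Family.P_d, T4Family.P_L]; exact hfloor
  have hcollar : cover (F.P K) '' (cubeIdxP' (F.P K) n hn1 M₀ ρ a).Ω 0 ⊆
      (if n - 1 = 0 then suppDomOfRecord F ν K s.Ω else s.Ω (n - 1)) := by
    rw [suppDomOfRecord_eq]
    exact Sect2.hcollar_cubeIdxP'_of_within_mem hM₁ s hsep hρ hM₀pos hfloor' hn1 hnk hx hy hxy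
  -- the smallness «7dL²M′α₀ ≤ c₁»
  have ha₀c : a0OfP F N M ρ B₁ c₁ ≤ c₁ / (56 * (F.L : ℝ) ^ 5 * M₂) := by rw [hM₂]; exact min_le_left _ _
  have ha₀w : a0OfP F N M ρ B₁ c₁ ≤ 1 / (8 * (M₂ : ℝ) * N * (28 * (F.L : ℝ) ^ 5 * B₁ * M₂) + 1) := by rw [hM₂]; exact min_le_right _ _
  have hc₁' : 7 * (F.P K).d * ((F.P K).L : ℝ) ^ 2 * (propCubeP (F.P K) n hn1 M₀ ρ hρ a).M * (((F.P K).L : ℝ) ^ 3 * ε (n - 1)) ≤ c₁ := by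
    rw [propCubeP_M, T4Family.P_d, T4Family.P_L]
    have h1 : 7 * (4 : ℕ) * (F.L : ℝ) ^ 2 * ((sideP (F.P K) M₀ ρ : ℕ) : ℝ) * ((F.L : ℝ) ^ 3 * ε (n - 1)) ≤ 28 * (F.L : ℝ) ^ 5 * M₂ * a0OfP F N M ρ B₁ c₁ := by
      have : 7 * (4 : ℕ) * (F.L : ℝ) ^ 2 * ((sideP (F.P K) M₀ ρ : ℕ) : ℝ) * ((F.L : ℝ) ^ 3 * ε (n - 1)) =
          28 * (F.L : ℝ) ^ 5 * ((sideP (F.P K) M₀ ρ : ℕ) : ℝ) * ε (n - 1) := by push_cast; ring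
      rw [this]; gcongr
    have h2 : 28 * (F.L : ℝ) ^ 5 * M₂ * a0OfP F N M ρ B₁ c₁ ≤ 28 * (F.L : ℝ) ^ 5 * M₂ * (c₁ / (56 * (F.L : ℝ) ^ 5 * M₂)) :=
      mul_le_mul_of_nonneg_left ha₀c (by positivity)
    have h3 : 28 * (F.L : ℝ) ^ 5 * M₂ * (c₁ / (56 * (F.L : ℝ) ^ 5 * M₂)) = c₁ / 2 := by field_simp; ring
    linarith
  -- the `2π`-window of the normalisation
  have h2π : (2 * boxWidth (bLo (F.P K).L (propCubeP (F.P K) n hn1 M₀ ρ hρ a).a n 0)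
      (bHi (F.P K).L (propCubeP (F.P K) n hn1 M₀ ρ hρ a).a (propCubeP (F.P K) n hn1 M₀ ρ hρ a).M n 0) + 1) *
      ((F.P K).eta n * N * (7 * (F.P K).d * ((F.P K).L : ℝ) ^ 2 * B₁ * (propCubeP (F.P K) n hn1 M₀ ρ hρ a).M * (((F.P K).L : ℝ) ^ 3 * ε (n - 1)) *
        (((F.P K).L : ℝ) ^ n * (F.P K).eta n)⁻¹)) < 2 * Real.pi := by
    have hbw := boxWidth_propCubeP (F.P K) n hn1 M₀ ρ hρ a
    rw [propCubeP_k] at hbw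
    rw [hbw, propCubeP_M, B12Eq115BackgroundPair.pow_mul_eta, inv_one, mul_one, T4Family.P_d, T4Family.P_L]
    have hη : (F.L : ℝ) ^ n * (F.P K).eta n = 1 := by have := B12Eq115BackgroundPair.pow_mul_eta (F.P K) n; rwa [T4Family.P_L] at this
    have hηpos : 0 < (F.P K).eta n := B3GkZeroTorusRescaled.eta_pos (F.P K) n
    have hW : (2 * ((4 : ℕ) * ((F.L : ℝ) ^ n * ((sideP (F.P K) M₀ ρ : ℕ) : ℝ) - 1)) + 1) * (F.P K).eta n ≤ 8 * ((sideP (F.P K) M₀ ρ : ℕ) : ℝ) := by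
      have : (2 * ((4 : ℕ) * ((F.L : ℝ) ^ n * ((sideP (F.P K) M₀ ρ : ℕ) : ℝ) - 1)) + 1) * (F.P K).eta n =
          8 * ((sideP (F.P K) M₀ ρ : ℕ) : ℝ) * ((F.L : ℝ) ^ n * (F.P K).eta n) - 7 * (F.P K).eta n := by push_cast; ring
      rw [this, hη, mul_one]; linarith
    have hr : 7 * (4 : ℕ) * (F.L : ℝ) ^ 2 * B₁ * ((sideP (F.P K) M₀ ρ : ℕ) : ℝ) * ((F.L : ℝ) ^ 3 * ε (n - 1)) ≤ 28 * (F.L : ℝ) ^ 5 * B₁ * M₂ * a0OfP F N M ρ B₁ c₁ := by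
      have : 7 * (4 : ℕ) * (F.L : ℝ) ^ 2 * B₁ * ((sideP (F.P K) M₀ ρ : ℕ) : ℝ) * ((F.L : ℝ) ^ 3 * ε (n - 1)) =
          28 * (F.L : ℝ) ^ 5 * B₁ * ((sideP (F.P K) M₀ ρ : ℕ) : ℝ) * ε (n - 1) := by push_cast; ring
      rw [this]; gcongr
    set X : ℝ := 8 * (M₂ : ℝ) * N * (28 * (F.L : ℝ) ^ 5 * B₁ * M₂) with hX
    have hX0 : 0 ≤ X := by positivity
    have hXa : X * a0OfP F N M ρ B₁ c₁ < 1 := by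
      calc X * a0OfP F N M ρ B₁ c₁ ≤ X * (1 / (X + 1)) := mul_le_mul_of_nonneg_left ha₀w hX0
        _ < 1 := by rw [mul_one_div, div_lt_one (by positivity)]; linarith
    have hNr : (0 : ℝ) ≤ N := Nat.cast_nonneg N
    calc (2 * ((4 : ℕ) * ((F.L : ℝ) ^ n * ((sideP (F.P K) M₀ ρ : ℕ) : ℝ) - 1)) + 1) *
          ((F.P K).eta n * N * (7 * (4 : ℕ) * (F.L : ℝ) ^ 2 * B₁ * ((sideP (F.P K) M₀ ρ : ℕ) : ℝ) * ((F.L : ℝ) ^ 3 * ε (n - 1))))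
        = ((2 * ((4 : ℕ) * ((F.L : ℝ) ^ n * ((sideP (F.P K) M₀ ρ : ℕ) : ℝ) - 1)) + 1) * (F.P K).eta n) *
          (N * (7 * (4 : ℕ) * (F.L : ℝ) ^ 2 * B₁ * ((sideP (F.P K) M₀ ρ : ℕ) : ℝ) * ((F.L : ℝ) ^ 3 * ε (n - 1)))) := by ring
      _ ≤ (8 * ((sideP (F.P K) M₀ ρ : ℕ) : ℝ)) * (N * (28 * (F.L : ℝ) ^ 5 * B₁ * M₂ * a0OfP F N M ρ B₁ c₁)) := by
          gcongr
      _ ≤ (8 * (M₂ : ℝ)) * (N * (28 * (F.L : ℝ) ^ 5 * B₁ * M₂ * a0OfP F N M ρ B₁ c₁)) := by gcongr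
      _ = X * a0OfP F N M ρ B₁ c₁ := by rw [hX]; ring
      _ < 1 := hXa
      _ < 2 * Real.pi := by linarith [Real.pi_gt_three]
  obtain ⟨u, A, h1, h2, h3, h4, h4', h5⟩ :=
    exists_localGauge152_REfiner153_coverBox_propCubeP_of_prop6P (P := F.P K) hd hB₁ (dvd_refl ρ) hρ hP6 U h17 h19 hn1 (by omega) hnK hεn1 a
      hinj hcollar hc₁' h2π
  -- the letters at `b9OfP·ε_n`
  have hbound : 2 * (7 * (F.P K).d * ((F.P K).L : ℝ) ^ 2 * B₁ * (propCubeP (F.P K) n hn1 M₀ ρ hρ a).M * (((F.P K).L : ℝ) ^ 3 * ε (n - 1))) <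
      b9OfP F M ρ B₁ * ε n := by
    rw [propCubeP_M, T4Family.P_d, T4Family.P_L, b9OfP]
    have : 2 * (7 * (4 : ℕ) * (F.L : ℝ) ^ 2 * B₁ * ((sideP (F.P K) M₀ ρ : ℕ) : ℝ) * ((F.L : ℝ) ^ 3 * ε (n - 1))) =
        56 * (F.L : ℝ) ^ 5 * B₁ * ((sideP (F.P K) M₀ ρ : ℕ) : ℝ) * ε (n - 1) := by push_cast; ring
    rw [this]
    calc 56 * (F.L : ℝ) ^ 5 * B₁ * ((sideP (F.P K) M₀ ρ : ℕ) : ℝ) * ε (n - 1) ≤ 56 * (F.L : ℝ) ^ 5 * B₁ * M₂ * (2 * ε n) := by gcongr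
      _ = (112 * (F.L : ℝ) ^ 5 * B₁ * M₂) * ε n := by ring
      _ < (112 * (F.L : ℝ) ^ 5 * B₁ * ((F.L * M + 44 + 2 * ρ : ℕ) : ℝ) + 1) * ε n := by
          rw [hM₂]; exact mul_lt_mul_of_pos_right (lt_add_one _) hεn
  exact ⟨u, A, h1, fun b hb => (h2 b hb).trans_lt hbound, fun q hq => (h3 q hq).trans_lt hbound, fun b hb => (h4 b hb).trans_lt hbound,
    fun b hb => (h4' b hb).trans_lt hbound, h5⟩

/-- ★ **THE SAME AT STUB 2′'s BARE `ρ₀ ≥ 1`** (`ρ := ρ₀·L ≥ L`, by `prop6Printed_zdCubP_anti`; floor `(11·4 + 4·(ρ₀L) + M₀ + Dw)·L`, constants `b9OfP F M (ρ₀L) B₁`,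
`a0OfP F N M (ρ₀L) B₁ c₁`) — the `Within`-witness door in the letters of V19's stub 2′ `stub_prop6MemberB8AtP13` (SOME `ρ₀ ≥ 1`).
[cite: Balaban1985Variational, (144) p.300, (150)–(153) p.301; Balaban1985RegularSpaces, Prop. 6 p.99, p.98 («M is a multiple of R₁M₁»); Balaban1984PropagatorsII, (2.12) p.225] -/
theorem gauge152_REfiner153_box_of_within_of_prop6P_of_one_le {B₁ c₁ : ℝ} (hB₁ : 0 ≤ B₁) (hc₁ : 0 < c₁) {ρ₀ : ℕ} (hρ₀ : 1 ≤ ρ₀)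
    (hP6 : letI : CStarAlgebra (MatA N) := {}; B8.Prop6Printed 4 (F.L : ℝ) B₁ c₁ (fun i : ZdIdx 4 F.L => zdCubP (MatA N) F.L ρ₀ i)) {M : ℕ} (hM : 1 ≤ M)
    (ν : Stage7Numerics) (g : ℕ → ℝ) (K k : ℕ) (s : SeqOfRecord F ν M g K k) (hsep : Sect2.SeqSeparated ν.M₁ s)
    (ε : ℕ → ℝ)
    (hε : ∀ m, m ≤ k → 0 < ε m ∧ ε m ≤ a0OfP F N M (ρ₀ * F.L) B₁ c₁) (hcomp : ∀ m, m < k → ε m ≤ 2 * ε (m + 1))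
    (U : GaugeField (F.P K) 0 (SU N))
    (h17 : ∀ m, m ≤ k → PlaqSmallOn (Sect2.omegaPlaqsTop s.Ω (suppDomOfRecord F ν K s.Ω) m) (ε m * (F.P K).eta m ^ 2) U)
    (h19 : ∀ m, m ≤ k → Sect2.CoDivSmallOn (Sect2.omegaBondsTop s.Ω (suppDomOfRecord F ν K s.Ω) m) (ε m * (F.P K).eta m ^ 3) U)
    {n : ℕ} (hn1 : 1 ≤ n) (hnk : n ≤ k) (hnK : n ≤ (F.P K).m + (F.P K).K) {M₀ : ℕ} (hM₀ : M₀ = M ∨ M₀ = F.L * M)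
    {Dw : ℕ} (hfloor : (11 * 4 + 4 * (ρ₀ * F.L) + M₀ + Dw) * F.L ≤ ν.M₁) (a : Pt (F.P K).d) {x y : Pt (F.P K).d}
    (hx : x ∈ cubeExt (side (F.P K).L M₀ n) a 0) (hy : cover (F.P K) y ∈ s.Ω n) (hxy : Within (Dw : ℤ) x y)
    (hinj : Set.InjOn (cover (F.P K))
      (cube (F.P K).L (propCubeP (F.P K) n hn1 M₀ (ρ₀ * F.L) (Nat.le_mul_of_pos_left F.L hρ₀) a).a (propCubeP (F.P K) n hn1 M₀ (ρ₀ * F.L) (Nat.le_mul_of_pos_left F.L hρ₀) a).M (propCubeP (F.P K) n hn1 M₀ (ρ₀ * F.L) (Nat.le_mul_of_pos_left F.L hρ₀) a).ρ n 0)) :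
    ∃ u : GaugeTransf (F.P K) 0 (SU N), ∃ A : PBond (F.P K) 0 → MatA N,
      (∀ b ∈ (Sect2.regionOfSet (F.P K)
          (cover (F.P K) '' box (F.P K).L (propCubeP (F.P K) n hn1 M₀ (ρ₀ * F.L) (Nat.le_mul_of_pos_left F.L hρ₀) a).a (propCubeP (F.P K) n hn1 M₀ (ρ₀ * F.L) (Nat.le_mul_of_pos_left F.L hρ₀) a).M n)).bonds,
          gaugeU (fun x => ιSU N (u x)) (fun b' => ιSU N (U b')) b = expI ((F.P K).eta n) (A b)) ∧
      (∀ b ∈ (Sect2.regionOfSet (F.P K)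
          (cover (F.P K) '' box (F.P K).L (propCubeP (F.P K) n hn1 M₀ (ρ₀ * F.L) (Nat.le_mul_of_pos_left F.L hρ₀) a).a (propCubeP (F.P K) n hn1 M₀ (ρ₀ * F.L) (Nat.le_mul_of_pos_left F.L hρ₀) a).M n)).bonds,
          ‖A b‖ < b9OfP F M (ρ₀ * F.L) B₁ * ε n) ∧
      (∀ q ∈ (Sect2.regionOfSet (F.P K)
          (cover (F.P K) '' box (F.P K).L (propCubeP (F.P K) n hn1 M₀ (ρ₀ * F.L) (Nat.le_mul_of_pos_left F.L hρ₀) a).a (propCubeP (F.P K) n hn1 M₀ (ρ₀ * F.L) (Nat.le_mul_of_pos_left F.L hρ₀) a).M n)).dpairs,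
          ‖grad ((F.P K).eta n) q.2.1 (fun y => A ⟨y, q.2.2⟩) q.1‖ < b9OfP F M (ρ₀ * F.L) B₁ * ε n) ∧
      (∀ b ∈ Sect2.bondsDeep (cover (F.P K) '' box (F.P K).L (propCubeP (F.P K) n hn1 M₀ (ρ₀ * F.L) (Nat.le_mul_of_pos_left F.L hρ₀) a).a (propCubeP (F.P K) n hn1 M₀ (ρ₀ * F.L) (Nat.le_mul_of_pos_left F.L hρ₀) a).M n),
          ‖Sect2.codiffCurlA ((F.P K).eta n) A b.src b.dir‖ < b9OfP F M (ρ₀ * F.L) B₁ * ε n) ∧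
      (∀ b ∈ Sect2.bondsDeep (cover (F.P K) '' box (F.P K).L (propCubeP (F.P K) n hn1 M₀ (ρ₀ * F.L) (Nat.le_mul_of_pos_left F.L hρ₀) a).a (propCubeP (F.P K) n hn1 M₀ (ρ₀ * F.L) (Nat.le_mul_of_pos_left F.L hρ₀) a).M n),
          ‖∑ ν' : Fin (F.P K).d, (((F.P K).eta n : ℝ) : ℂ)⁻¹ •
              (grad ((F.P K).eta n) ν' (fun y => A ⟨y, b.dir⟩) (b.src.unshift ν') - grad ((F.P K).eta n) ν' (fun y => A ⟨y, b.dir⟩) b.src)‖ <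
            b9OfP F M (ρ₀ * F.L) B₁ * ε n) ∧
      (∀ D' : Domains (F.P K),
        LinearMap.ker (QpE D') ≤ LinearMap.ker (QpE (cubeDomains (F.P K) (propCubeP (F.P K) n hn1 M₀ (ρ₀ * F.L) (Nat.le_mul_of_pos_left F.L hρ₀) a).a (propCubeP (F.P K) n hn1 M₀ (ρ₀ * F.L) (Nat.le_mul_of_pos_left F.L hρ₀) a).M (ρ₀ * F.L) n hnK)) →
        ∀ φ : MatA N →L[ℂ] ℂ,
          RE D' ((F.P K).eta n)⁻¹ (dsE ((F.P K).eta n)⁻¹ (WithLp.toLp 2 fun b => (φ (A b)).re : BondSpace (F.P K))) = 0 ∧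
          RE D' ((F.P K).eta n)⁻¹ (dsE ((F.P K).eta n)⁻¹ (WithLp.toLp 2 fun b => (φ (A b)).im : BondSpace (F.P K))) = 0) := by
  letI : CStarAlgebra (MatA N) := {}
  exact gauge152_REfiner153_box_of_within_of_prop6P hB₁ hc₁ (prop6Printed_zdCubP_anti (fun i : ZdIdx 4 F.L => i) (Dvd.intro F.L rfl) hP6) hM ν g K k
    (Nat.le_mul_of_pos_left F.L hρ₀) s hsep ε hε hcomp U h17 h19 hn1 hnk hnK hM₀ hfloor a hx hy hxy hinj

end Meeting

/-! ## §3  The (9)–(10) composition for critical configurations -/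

section NineStep

/-- ★ **THE (9)–(10) COMPOSITION FOR CRITICAL CONFIGURATIONS, WITH (153) AT EVERY KERNEL-FINER FAMILY**: p607847's `gauge9_152_RE153_box_of_prop8TopStep_of_prop6P` binder
block (stub 1's `Prop8RegSepTopStep` the HYPOTHESIS `h8`, Prop. 6 on print's class the HYPOTHESIS `hP6`), sixth clause over every `D′` with `ker Q′_{D′} ≤ ker Q′_{cubeDomains 𝔔}`;
nesting only.
[cite: Balaban1985Variational, Thm 1 (8)–(10) p.279, (150)–(153) p.301, Prop. 8 p.304; Balaban1985RegularSpaces, Prop. 6 p.99; Balaban1984PropagatorsII, (2.10)–(2.12) p.225] -/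
theorem gauge9_152_REfiner153_box_of_prop8TopStep_of_prop6P {B₁ c₁ B₃ a₀ a₁ : ℝ} (hB₁ : 0 ≤ B₁) (hc₁ : 0 < c₁) {ρ : ℕ}
    (hP6 : letI : CStarAlgebra (MatA N) := {}; B8.Prop6Printed 4 (F.L : ℝ) B₁ c₁ (fun i : ZdIdx 4 F.L => zdCubP (MatA N) F.L ρ i)) {M : ℕ} (hM : 1 ≤ M)
    (h8 : Prop8RegSepTopStep F N (fun ν K Ω => suppDomOfRecord F ν K Ω) B₃ a₀ a₁) (hB₃ : 0 < B₃) (ha : B₃ * a₁ ≤ a0OfP F N M ρ B₁ c₁)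
    (ν : Stage7Numerics) (g : ℕ → ℝ) (K k : ℕ) (hρ : (F.P K).L ≤ ρ) (s : SeqOfRecord F ν M g K k) (hsep : Sect2.SeqSeparated ν.M₁ s) (hM₁ : 0 < ν.M₁)
    (hfloor : (11 * 4 + 4 * ρ) * F.L ≤ ν.M₁) (hk : 1 ≤ k) (ε₀ : ℝ) (δ : ℕ → ℝ)
    (hδ : ∀ m, m ≤ k → 0 < δ m ∧ δ m ≤ a₁ ∧ B₃ * δ m ≤ ε₀) (hcomp : ∀ m, m < k → δ m ≤ 2 * δ (m + 1)) (hcomp' : ∀ m, m < k → δ (m + 1) ≤ 2 * δ m)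
    (hε₀ : ε₀ ≤ a₀) (W : MSField (F.P K) (SU N)) (h7 : Sect2.DataSmall7PTop (avOfRecord F N K) s.Ω (suppDomOfRecord F ν K s.Ω) k δ W)
    (U : GaugeField (F.P K) 0 (SU N))
    (h17 : ∀ m, m ≤ k → PlaqSmallOn (Sect2.omegaPlaqsTop s.Ω (suppDomOfRecord F ν K s.Ω) m) (ε₀ * (F.P K).eta m ^ 2) U)
    (h19 : Sect2.CoDivClassOnTop s.Ω (suppDomOfRecord F ν K s.Ω) k ε₀ U) (hfib : AgreeOn (genSet s.Ω k) (avgFamily (avOfRecord F N K) U) W)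
    (hcrit : IsCritOnFibre F N K (genSet s.Ω k) W U)
    {n : ℕ} (hn1 : 1 ≤ n) (hnk : n ≤ k) (hnK : n ≤ (F.P K).m + (F.P K).K) {M₀ : ℕ} (hM₀ : M₀ = M ∨ M₀ = F.L * M)
    (a : Pt (F.P K).d) (hΩ : cubeEnl (F.P K) (side (F.P K).L M₀ n) a 0 ⊆ s.Ω n)
    (hinj : Set.InjOn (cover (F.P K))
      (cube (F.P K).L (propCubeP (F.P K) n hn1 M₀ ρ hρ a).a (propCubeP (F.P K) n hn1 M₀ ρ hρ a).M (propCubeP (F.P K) n hn1 M₀ ρ hρ a).ρ n 0)) :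
    ∃ u : GaugeTransf (F.P K) 0 (SU N), ∃ A : PBond (F.P K) 0 → MatA N,
      (∀ b ∈ (Sect2.regionOfSet (F.P K)
          (cover (F.P K) '' box (F.P K).L (propCubeP (F.P K) n hn1 M₀ ρ hρ a).a (propCubeP (F.P K) n hn1 M₀ ρ hρ a).M n)).bonds,
          gaugeU (fun x => ιSU N (u x)) (fun b' => ιSU N (U b')) b = expI ((F.P K).eta n) (A b)) ∧
      (∀ b ∈ (Sect2.regionOfSet (F.P K)
          (cover (F.P K) '' box (F.P K).L (propCubeP (F.P K) n hn1 M₀ ρ hρ a).a (propCubeP (F.P K) n hn1 M₀ ρ hρ a).M n)).bonds,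
          ‖A b‖ < b9OfP F M ρ B₁ * B₃ * δ n) ∧
      (∀ q ∈ (Sect2.regionOfSet (F.P K)
          (cover (F.P K) '' box (F.P K).L (propCubeP (F.P K) n hn1 M₀ ρ hρ a).a (propCubeP (F.P K) n hn1 M₀ ρ hρ a).M n)).dpairs,
          ‖grad ((F.P K).eta n) q.2.1 (fun y => A ⟨y, q.2.2⟩) q.1‖ < b9OfP F M ρ B₁ * B₃ * δ n) ∧
      (∀ b ∈ Sect2.bondsDeep (cover (F.P K) '' box (F.P K).L (propCubeP (F.P K) n hn1 M₀ ρ hρ a).a (propCubeP (F.P K) n hn1 M₀ ρ hρ a).M n),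
          ‖Sect2.codiffCurlA ((F.P K).eta n) A b.src b.dir‖ < b9OfP F M ρ B₁ * B₃ * δ n) ∧
      (∀ b ∈ Sect2.bondsDeep (cover (F.P K) '' box (F.P K).L (propCubeP (F.P K) n hn1 M₀ ρ hρ a).a (propCubeP (F.P K) n hn1 M₀ ρ hρ a).M n),
          ‖∑ ν' : Fin (F.P K).d, (((F.P K).eta n : ℝ) : ℂ)⁻¹ •
              (grad ((F.P K).eta n) ν' (fun y => A ⟨y, b.dir⟩) (b.src.unshift ν') - grad ((F.P K).eta n) ν' (fun y => A ⟨y, b.dir⟩) b.src)‖ <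
            b9OfP F M ρ B₁ * B₃ * δ n) ∧
      (∀ D' : Domains (F.P K),
        LinearMap.ker (QpE D') ≤ LinearMap.ker (QpE (cubeDomains (F.P K) (propCubeP (F.P K) n hn1 M₀ ρ hρ a).a (propCubeP (F.P K) n hn1 M₀ ρ hρ a).M ρ n hnK)) →
        ∀ φ : MatA N →L[ℂ] ℂ,
          RE D' ((F.P K).eta n)⁻¹ (dsE ((F.P K).eta n)⁻¹ (WithLp.toLp 2 fun b => (φ (A b)).re : BondSpace (F.P K))) = 0 ∧
          RE D' ((F.P K).eta n)⁻¹ (dsE ((F.P K).eta n)⁻¹ (WithLp.toLp 2 fun b => (φ (A b)).im : BondSpace (F.P K))) = 0) := by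
  obtain ⟨u, A, h1, h2, h3, h4, h5, h6⟩ := gauge9_152_RE153_box_of_prop8TopStep_of_prop6P hB₁ hc₁ hP6 hM h8 hB₃ ha ν g K k hρ s hsep hM₁ hfloor hk ε₀ δ
    hδ hcomp hcomp' hε₀ W h7 U h17 h19 hfib hcrit hn1 hnk hnK hM₀ a hΩ hinj
  exact ⟨u, A, h1, h2, h3, h4, h5, fun D' hD' φ => ⟨RE_eq_zero_of_ker_le hD' (h6 φ).1, RE_eq_zero_of_ker_le hD' (h6 φ).2⟩⟩

end NineStep

end Literature.MathematicalPhysics.QuantumFieldTheory.Balaban1983to89.Node00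

end
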